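import Summits.HodgeConjecture.HodgeConjecture.Theorems.R90S4WeylCountTLetter          -- ★ p864300 (this seat): `IsTwistedWeylCountT`, `isTwistedWeylCountT_of_isFinerCount` (brings ★ CountFiner, TubeReachability, TrivialTypes, dict)
import Summits.HodgeConjecture.HodgeConjecture.Theorems.R90S4StableRegroupOfPlain        -- ★ p863960 (this seat): `isStableWeylMeasure_stableCartanMeasure_of_dict` (S-WIF on the term of record)
import HarnessLib

/-!
# R90-TF · S4 «Ch. 13.1–2» — THE (DICT)-SIDE GLUE: member packages + the finer count + the ε-Weyl values ⇒ `IsStableTransportDict ∧ IsTwistedWeylCountT` IN ONE CALL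
# (Rogawski 1990, §12.5 pp. 182, 186; §3.6 pp. 28–31)

Cell `hodgecm-mathlib`, crux H413 (`stmt-HodgeConjecture-24833`, lane `--supports … --as helper`), route of record `HCCMUnconditional` (no route verbs;
count-neutral).  Programme R90-TF, section S4, dealer K2E2-plan (g7): DEAL BY NAME 2026-09-05T01:53:46Z «(ii) `Theorems/R90S4StableDictOfMemberPackages.lean` = the (DICT)-side
GLUE «member packages + `IsFinerCount` + the per-type rows `hwF` ⇒ `IsStableTransportDict L v C n ∧ IsTwistedWeylCountT L v C n`» in ONE call — exactly what C ED. 6's consumer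
line instantiates (`hdict`, `hwc`)»; seat K2E3-p12 (g10).  PURE ASSEMBLY of ★ names, hypothesis-first over the per-member packages (paid per Cartan type by the (DICT) hands:
(0) K2E3-p31, (1) R90-C131-p01, (2) K2E3-p27, (3) this seat ∕ K2E3-p27; cheap members via ★ `exists_memberPackage_of_stable_eq_class`).

## CONTENTS
* §1 **`isStableTransportDict_and_isTwistedWeylCountT_of_forall_member`** — inputs: the `hZ`, `hirr` letters of ★ CARTAN-ALL; visible class counts `μ`, fibre counts `N`,
  ε-Weyl values `wF`; the `hmem` row of ★ `isStableTransportDict_of_forall_member` (per member: own length `k = μ i`, targets `τ`, transports `e`, fibre counts, clauses (S)(W)(B));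
  clause (N) `hN`; the FINER COUNT ★ `IsFinerCount μ N (fun i => [N(T_i):T_i]) wF`; the row (W̃ε-VAL) `hwF : [Ñ^ε_{T_k} : T̃_k] = wF k`.  Output: BOTH letters — `hdict` for ★ (B2-S)
  `isStableWeylMeasure_stableCartanMeasure_of_dict` (its (C) clause is ★ `IsFinerCount.sCount`) and `hwc` for the (B1-Σ) assembly (★ `isTwistedWeylCountT_of_isFinerCount`).
* §2 **`isStableWeylMeasure_and_isTwistedWeylCountT_of_forall_member`** — the same inputs plus the (B2-N) measure letters ⇒ S-WIF on `stableCartanMeasure L v C tT n` (with its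
  regular support) ∧ the T-count letter: the two facts FILE C ED. 6's (W-NP) glue reads off the (DICT) side.

HONEST LABEL: HC_CM is proved only modulo the 7 printed citations (2 remaining named inputs: hLiu418 = stmt-HodgeConjecture-24832, h413 = stmt-HodgeConjecture-24833) until rung 0
closes.  Glue only: the member packages, the finer count and the ε-Weyl values are the per-type payments still OPEN for types (1)(2) ((0)(3) cheap); T-WIF (B1) and (W-NP) stay OPEN.
REL ≠ ★ ≠ BUILT.  Theorems only; no instance, no notation, no `sorry`.

## References
* [Rogawski1990] J. D. Rogawski, *Automorphic Representations of Unitary Groups in Three Variables*, Ann. of Math. Stud. 123 (1990), §12.5 pp. 182, 186; §3.6 pp. 28–31.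
-/

set_option autoImplicit false
set_option linter.dupNamespace false

noncomputable section

open MeasureTheory Measure Set Filter Topology Function NumberField IsDedekindDomain
open Literature.MeasureTheory.Group
open Literature.NumberTheory.Automorphic Literature.NumberTheory.Automorphic.UnitaryGroup Literature.NumberTheory.Rogawski1990
open Literature.NumberTheory.Rogawski1990.Ch4Sec10
open Summit.HodgeConjecture.HodgeConjecture.Cruxes.H413
open scoped ENNReal NNReal MatrixGroups Pointwise

namespace Summit.HodgeConjecture.HodgeConjecture.R90.S4

section DictGlue

variable (L : Type) [Field L] [NumberField L] [IsCMField L] (v : HeightOneSpectrum (𝓞 ↥(maximalRealSubfield L)))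

/-! ## §1 Both letters from the member packages -/

/-- **THE (DICT)-SIDE GLUE: `IsStableTransportDict L v C n ∧ IsTwistedWeylCountT L v C n` from the member packages, the finer count and the ε-Weyl values, in one call.**
Inputs: `hZ`, `hirr` (★ CARTAN-ALL); visible `μ` (class counts), `N` (fibre counts), `wF` (ε-Weyl orders); the `hmem` row of ★ `isStableTransportDict_of_forall_member`; clause (N) `hN`;
★ `IsFinerCount μ N (fun i => [N(T_i):T_i]) wF`; the row (W̃ε-VAL) `hwF`.  The dictionary's Weyl count (C) is ★ `IsFinerCount.sCount`; the T-letter is ★ `isTwistedWeylCountT_of_isFinerCount`.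
[cite: Rogawski1990, §12.5 pp. 182, 186; §3.6 pp. 28–31] -/
theorem isStableTransportDict_and_isTwistedWeylCountT_of_forall_member {C : Finset (Subgroup (Gqs L v))} {n : Gqs L v → ℕ}
    (hZ : ∀ T ∈ C, ∃ γ₀ : Gqs L v, IsRegularElt (γ₀.val : GL (Fin 3) (LocalRing L v)) ∧ T = Subgroup.centralizer ({γ₀} : Set (Gqs L v)))
    (hirr : ∀ T ∈ C, ∀ T' ∈ C, T ≠ T' → ∀ y : Gqs L v, ¬ ∀ h : Gqs L v, h ∈ T' ↔ y⁻¹ * h * y ∈ T)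
    (μ : ↥C → ℕ) (N : ↥C → ↥C → ℕ) (wF : ↥C → ℕ)
    (hmem : ∀ i : ↥C, ∃ (k : ℕ) (τ : Fin k → ↥C) (e : ∀ j : Fin k, ↥(i : Subgroup (Gqs L v)) ≃ₜ* ↥((τ j : ↥C) : Subgroup (Gqs L v))),
      k = μ i ∧ (∀ k' : ↥C, Nat.card {j : Fin k // τ j = k'} = N i k') ∧
      (∀ (j : Fin k) (t : ↥(i : Subgroup (Gqs L v))),
          IsStablyConjGAt L (R90.S4.splitFormGL L) v (t : Gqs L v) ((e j t : ↥((τ j : ↥C) : Subgroup (Gqs L v))) : Gqs L v)) ∧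
      (∀ (j : Fin k) (t : ↥(i : Subgroup (Gqs L v))), IsRegularElt (((t : Gqs L v)).val : GL (Fin 3) (LocalRing L v)) →
          cartanWeight L v ((τ j : ↥C) : Subgroup (Gqs L v)) (e j t) = cartanWeight L v (i : Subgroup (Gqs L v)) t) ∧
      (∀ t : ↥(i : Subgroup (Gqs L v)), IsRegularElt (((t : Gqs L v)).val : GL (Fin 3) (LocalRing L v)) →
          Set.BijOn (fun j : Fin k => ConjClasses.mk ((e j t : ↥((τ j : ↥C) : Subgroup (Gqs L v))) : Gqs L v)) Set.univ
            {c : ConjClasses (Gqs L v) | IsStablyConjGAt L (R90.S4.splitFormGL L) v (t : Gqs L v) (Quotient.out c)}))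
    (hN : ∀ (i : ↥C) (t : ↥(i : Subgroup (Gqs L v))), IsRegularElt (((t : Gqs L v)).val : GL (Fin 3) (LocalRing L v)) → n (t : Gqs L v) = μ i)
    (hF : IsFinerCount μ N
      (fun i : ↥C => ((i : Subgroup (Gqs L v)).subgroupOf (Subgroup.normalizer ((i : Subgroup (Gqs L v)) : Set (Gqs L v)))).index) wF)
    (hwF : ∀ (k : ↥C) (tk : ↥(k : Subgroup (Gqs L v))), IsRegularElt (((tk : Gqs L v)).val : GL (Fin 3) (LocalRing L v)) →
      ∀ N' : Subgroup (GtLoc L v),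
        (∀ m : GtLoc L v, m ∈ N' ↔
          m ∈ Subgroup.normalizer ((Subgroup.centralizer ({((tk : Gqs L v).val : GtLoc L v)} : Set (GtLoc L v)) : Subgroup (GtLoc L v)) : Set (GtLoc L v)) ∧
            m * (epsLoc L (R90.S4.splitFormGL L) v m)⁻¹ ∈ Subgroup.centralizer ({((tk : Gqs L v).val : GtLoc L v)} : Set (GtLoc L v))) →
        ((Subgroup.centralizer ({((tk : Gqs L v).val : GtLoc L v)} : Set (GtLoc L v))).subgroupOf N').index = wF k) :
    IsStableTransportDict L v C n ∧ IsTwistedWeylCountT L v C n :=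
  ⟨isStableTransportDict_of_forall_member L v μ N hmem hN hF.sCount,
    isTwistedWeylCountT_of_isFinerCount L v hZ hirr μ N wF hmem hN hF hwF⟩

/-! ## §2 S-WIF on the term of record together with the T-letter -/

/-- **S-WIF on `stableCartanMeasure L v C tT n` (with its regular support) AND the letter `IsTwistedWeylCountT L v C n`, from the member packages** (`v` non-split): §1 followed by
★ (B2-S) `isStableWeylMeasure_stableCartanMeasure_of_dict` — the pair FILE C ED. 6's (W-NP) glue reads off the (DICT) side (the T-WIF half reads `hwc` through the (B1) assembly).
[cite: Rogawski1990, §12.5 pp. 182, 186; §3.6 pp. 28–31; §4.3 (4.3.1) p. 43] -/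
theorem isStableWeylMeasure_and_isTwistedWeylCountT_of_forall_member (hns : ∀ w : PlacesOver L v, IsCMField.complexConj L • w.1 = w.1)
    [MeasurableSpace (Gqs L v)] [BorelSpace (Gqs L v)]
    [∀ γ' : Gqs L v, MeasurableSpace (Gqs L v ⧸ Subgroup.centralizer ({γ'} : Set (Gqs L v)))]
    [∀ γ' : Gqs L v, BorelSpace (Gqs L v ⧸ Subgroup.centralizer ({γ'} : Set (Gqs L v)))]
    {C : Finset (Subgroup (Gqs L v))}
    (hZ : ∀ T ∈ C, ∃ γ₀ : Gqs L v, IsRegularElt (γ₀.val : GL (Fin 3) (LocalRing L v)) ∧ T = Subgroup.centralizer ({γ₀} : Set (Gqs L v)))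
    (hcpt : ∀ T ∈ C, T ≠ (cmBorelTriple L 3 v).M → IsCompact (T : Set (Gqs L v)))
    (hcov : ∀ γ : Gqs L v, IsRegularElt (γ.val : GL (Fin 3) (LocalRing L v)) →
      ∃ T ∈ C, ∃ x : Gqs L v, ∀ g : Gqs L v, g ∈ Subgroup.centralizer ({γ} : Set (Gqs L v)) ↔ x⁻¹ * g * x ∈ T)
    (hirr : ∀ T ∈ C, ∀ T' ∈ C, T ≠ T' → ∀ y : Gqs L v, ¬ ∀ h : Gqs L v, h ∈ T' ↔ y⁻¹ * h * y ∈ T)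
    (νG : Measure (Gqs L v)) [νG.IsHaarMeasure] [νG.IsMulRightInvariant]
    (mG : OrbitalMeasureFamily (Gqs L v)) (hcan : mG.IsCanonical (fun γ : Gqs L v => IsRegularElt (γ.val : GL (Fin 3) (LocalRing L v))) νG)
    (tT : ∀ i : ↥C, Measure ↥(i : Subgroup (Gqs L v))) (htH : ∀ i : ↥C, (tT i).IsHaarMeasure) (htI : ∀ i : ↥C, (tT i).IsInvInvariant)
    (htc : ∀ i : ↥C, tT i (compactCore ↥(i : Subgroup (Gqs L v))) = 1)
    {n : Gqs L v → ℕ} (μ : ↥C → ℕ) (N : ↥C → ↥C → ℕ) (wF : ↥C → ℕ)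
    (hmem : ∀ i : ↥C, ∃ (k : ℕ) (τ : Fin k → ↥C) (e : ∀ j : Fin k, ↥(i : Subgroup (Gqs L v)) ≃ₜ* ↥((τ j : ↥C) : Subgroup (Gqs L v))),
      k = μ i ∧ (∀ k' : ↥C, Nat.card {j : Fin k // τ j = k'} = N i k') ∧
      (∀ (j : Fin k) (t : ↥(i : Subgroup (Gqs L v))),
          IsStablyConjGAt L (R90.S4.splitFormGL L) v (t : Gqs L v) ((e j t : ↥((τ j : ↥C) : Subgroup (Gqs L v))) : Gqs L v)) ∧
      (∀ (j : Fin k) (t : ↥(i : Subgroup (Gqs L v))), IsRegularElt (((t : Gqs L v)).val : GL (Fin 3) (LocalRing L v)) →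
          cartanWeight L v ((τ j : ↥C) : Subgroup (Gqs L v)) (e j t) = cartanWeight L v (i : Subgroup (Gqs L v)) t) ∧
      (∀ t : ↥(i : Subgroup (Gqs L v)), IsRegularElt (((t : Gqs L v)).val : GL (Fin 3) (LocalRing L v)) →
          Set.BijOn (fun j : Fin k => ConjClasses.mk ((e j t : ↥((τ j : ↥C) : Subgroup (Gqs L v))) : Gqs L v)) Set.univ
            {c : ConjClasses (Gqs L v) | IsStablyConjGAt L (R90.S4.splitFormGL L) v (t : Gqs L v) (Quotient.out c)}))
    (hN : ∀ (i : ↥C) (t : ↥(i : Subgroup (Gqs L v))), IsRegularElt (((t : Gqs L v)).val : GL (Fin 3) (LocalRing L v)) → n (t : Gqs L v) = μ i)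
    (hF : IsFinerCount μ N
      (fun i : ↥C => ((i : Subgroup (Gqs L v)).subgroupOf (Subgroup.normalizer ((i : Subgroup (Gqs L v)) : Set (Gqs L v)))).index) wF)
    (hwF : ∀ (k : ↥C) (tk : ↥(k : Subgroup (Gqs L v))), IsRegularElt (((tk : Gqs L v)).val : GL (Fin 3) (LocalRing L v)) →
      ∀ N' : Subgroup (GtLoc L v),
        (∀ m : GtLoc L v, m ∈ N' ↔
          m ∈ Subgroup.normalizer ((Subgroup.centralizer ({((tk : Gqs L v).val : GtLoc L v)} : Set (GtLoc L v)) : Subgroup (GtLoc L v)) : Set (GtLoc L v)) ∧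
            m * (epsLoc L (R90.S4.splitFormGL L) v m)⁻¹ ∈ Subgroup.centralizer ({((tk : Gqs L v).val : GtLoc L v)} : Set (GtLoc L v))) →
        ((Subgroup.centralizer ({((tk : Gqs L v).val : GtLoc L v)} : Set (GtLoc L v))).subgroupOf N').index = wF k) :
    (IsStableWeylMeasure L (R90.S4.splitFormGL L) v νG mG (stableCartanMeasure L v C tT n) ∧
        ∀ᵐ γ ∂(stableCartanMeasure L v C tT n), IsRegularElt (γ.val : GL (Fin 3) (LocalRing L v))) ∧
      IsTwistedWeylCountT L v C n := by
  obtain ⟨hdict, hwc⟩ := isStableTransportDict_and_isTwistedWeylCountT_of_forall_member L v hZ hirr μ N wF hmem hN hF hwF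
  exact ⟨isStableWeylMeasure_stableCartanMeasure_of_dict L v hns hZ hcpt hcov hirr νG mG hcan tT htH htI htc hdict, hwc⟩

end DictGlue

end Summit.HodgeConjecture.HodgeConjecture.R90.S4

end
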